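import Mathlib
import HarnessLib
import Summits.ValiantsHypothesis.ValiantsHypothesis.Theorems.MonotoneRestorationOrbitRestorationQPTransposeSpan

/-!
# Matrix-symmetric affine products with row-untwisted ROW groupings are narrow (supports form, by transposition)

Route MonotoneRestoration, crux `OrbitRestorationQP` (stmt-ValiantsHypothesis-18293), SPAN-currency lane of the open
sub-rung A_∞ (`stub_sigmaPiSigmaValue`), `ΠΣ` part; residue R3.  Helper (`--supports`), def-free.  The mirror of
`SuperAtoms.prod_mem_narrowSpan_of_colStabUntwisted_supports` under `x_{ab} ↦ x_{ba}` (transpose tool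
`SuperAtoms.rename_swap_mem_narrowSpan`):

* `rowLabel_transpose_*` bookkeeping is inlined: a ROW-support labelling `R` of the factors (scalar-invariant,
  row-equivariant, column-invariant, factors fixed by the row renamings fixing `R(L_i)` pointwise — as delivered by
  `LocalFactors.exists_rowColSupports_of_matrixSymmetric`) becomes a column-support labelling `q ↦ R(qᵀ)` of the
  transposed factors;
* **`prod_mem_narrowSpan_of_rowStabUntwisted_supports`** — if the ROW groupings `H_A = Π_{R(L_i) = A} L_i` have trivial
  `Sym(A)`-character (`σ • A = A`, `σ · H_A = c · H_A ⇒ c = 1`, occurring `A`), then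
  `C a · Π_i L_i ∈ span_ℂ {hom_{F,n} : tw F ≤ 2c₀ + 1}` — column sign twists of any kind allowed.

With the column version: a matrix-symmetric `ΠΣ` polynomial is narrow as soon as the groupings of ONE side are untwisted;
the residue of span-A₁ is the doubly twisted type (evidence `SIGN-LANE-g7g6.md` on the crux item).  No registered stub is
closed; the crux and VP ≠ VNP are not moved. [folklore; cite: DwivediPagoSeppelt2026, §8]
-/

noncomputable section

open scoped Pointwise

-- `Summit.ValiantsHypothesis.ValiantsHypothesis.…` is the tree's single-conjunct layout (Sub = Summit).
set_option linter.dupNamespace false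

namespace Summit.ValiantsHypothesis.ValiantsHypothesis.Theorems

namespace SuperAtoms

open MvPolynomial Finset Equiv ProductAction
open Literature.Computability.AlgebraicComplexity (homPoly)
open Literature.Combinatorics.SimpleGraph (treewidth)

variable {n : ℕ}

/-- **MATRIX-SYMMETRIC AFFINE PRODUCTS WITH ROW-UNTWISTED ROW GROUPINGS ARE NARROW (supports form).**
[folklore; cite: DwivediPagoSeppelt2026, §8; Weyl1939, Chap. II §3; Macdonald1995, §I.2] -/
theorem prod_mem_narrowSpan_of_rowStabUntwisted_supports (c₀ : ℕ) (hc₀ : 2 * c₀ < n)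
    {ι : Type} [Fintype ι] (L : ι → MvPolynomial (Fin n × Fin n) ℂ) (a : ℂ) (hL1 : ∀ i, (L i).totalDegree = 1)
    (hf0 : C a * ∏ i, L i ≠ 0)
    (hfix : ∀ σ τ : Perm (Fin n),
      rename (fun P : Fin n × Fin n => (σ P.1, τ P.2)) (C a * ∏ i, L i) = C a * ∏ i, L i)
    (R : MvPolynomial (Fin n × Fin n) ℂ → Finset (Fin n))
    (R1 : ∀ (q : MvPolynomial (Fin n × Fin n) ℂ) (u : ℂ), u ≠ 0 → R (C u * q) = R q)
    (R2 : ∀ (q : MvPolynomial (Fin n × Fin n) ℂ) (σ : Perm (Fin n)), R (vact (K := ℂ) rowHom σ q) = σ • R q)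
    (R3 : ∀ (q : MvPolynomial (Fin n × Fin n) ℂ) (τ : Perm (Fin n)), R (vact (K := ℂ) colHom τ q) = R q)
    (hRk : ∀ i, (R (L i)).card ≤ c₀)
    (hRfix : ∀ (i : ι) (ρ : Perm (Fin n)), (∀ x ∈ R (L i), ρ x = x) → vact (K := ℂ) rowHom ρ (L i) = L i)
    (Hstab : ∀ (σ : Perm (Fin n)) (A : Finset (Fin n)) (c : ℂ), (∃ i, R (L i) = A) → σ • A = A →
      rename (fun P : Fin n × Fin n => (σ P.1, P.2)) (∏ i ∈ (univ : Finset ι).filter (fun i => R (L i) = A), L i) =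
        C c * ∏ i ∈ (univ : Finset ι).filter (fun i => R (L i) = A), L i → c = 1) :
    (C a * ∏ i, L i) ∈ Submodule.span ℂ {p : MvPolynomial (Fin n × Fin n) ℂ |
        ∃ (a b : ℕ) (E : Multiset (Fin a × Fin b)),
          treewidth (SimpleGraph.fromRel fun u v : Fin a ⊕ Fin b =>
            ∃ e ∈ E, u = Sum.inl e.1 ∧ v = Sum.inr e.2) ≤ 2 * c₀ + 1 ∧ p = homPoly E n ℂ} := by
  classical
  have hL0 : ∀ i, L i ≠ 0 := by
    intro i h
    exact hf0 (by rw [Finset.prod_eq_zero (Finset.mem_univ i) h, mul_zero])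
  -- transpose everything
  set t : MvPolynomial (Fin n × Fin n) ℂ →ₐ[ℂ] MvPolynomial (Fin n × Fin n) ℂ :=
    rename (fun P : Fin n × Fin n => (P.2, P.1)) with ht
  have htt : ∀ q, t (t q) = q := fun q => rename_swap_rename_swap q
  have htinj : Function.Injective t :=
    rename_injective _ (fun P Q h => Prod.ext (Prod.mk.inj h).2 (Prod.mk.inj h).1)
  have htC : ∀ u : ℂ, t (C u) = C u := fun u => rename_C _ u
  have htrow : ∀ (σ : Perm (Fin n)) (q : MvPolynomial (Fin n × Fin n) ℂ),
      rename (fun P : Fin n × Fin n => (σ P.1, P.2)) (t q) = t (rename (fun P : Fin n × Fin n => (P.1, σ P.2)) q) := by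
    intro σ q
    rw [ht, rename_rename, rename_rename]
    rfl
  have htcol : ∀ (τ : Perm (Fin n)) (q : MvPolynomial (Fin n × Fin n) ℂ),
      rename (fun P : Fin n × Fin n => (P.1, τ P.2)) (t q) = t (rename (fun P : Fin n × Fin n => (τ P.1, P.2)) q) := by
    intro τ q
    rw [ht, rename_rename, rename_rename]
    rfl
  have htboth : ∀ (σ τ : Perm (Fin n)) (q : MvPolynomial (Fin n × Fin n) ℂ),
      rename (fun P : Fin n × Fin n => (σ P.1, τ P.2)) (t q) = t (rename (fun P : Fin n × Fin n => (τ P.1, σ P.2)) q) := by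
    intro σ τ q
    rw [ht, rename_rename, rename_rename]
    rfl
  have htvrow : ∀ (σ : Perm (Fin n)) (q : MvPolynomial (Fin n × Fin n) ℂ),
      vact (K := ℂ) rowHom σ (t q) = t (vact (K := ℂ) colHom σ q) := by
    intro σ q
    rw [vact_rowHom_eq_rename, vact_colHom_eq_rename, htrow]
  have htvcol : ∀ (τ : Perm (Fin n)) (q : MvPolynomial (Fin n × Fin n) ℂ),
      vact (K := ℂ) colHom τ (t q) = t (vact (K := ℂ) rowHom τ q) := by
    intro τ q
    rw [vact_rowHom_eq_rename, vact_colHom_eq_rename, htcol]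
  set L' : ι → MvPolynomial (Fin n × Fin n) ℂ := fun i => t (L i) with hL'
  have hf' : t (C a * ∏ i, L i) = C a * ∏ i, L' i := by
    simp only [hL', map_mul, map_prod, htC]
  have hL1' : ∀ i, (L' i).totalDegree = 1 := by
    intro i
    apply le_antisymm ((totalDegree_rename_le _ _).trans (hL1 i).le)
    have h := totalDegree_rename_le (fun P : Fin n × Fin n => (P.2, P.1)) (L' i)
    have h2 : rename (fun P : Fin n × Fin n => (P.2, P.1)) (L' i) = L i := htt (L i)
    rw [h2, hL1 i] at h
    exact h
  have hf0' : C a * ∏ i, L' i ≠ 0 := by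
    rw [← hf']
    intro h
    exact hf0 (htinj (by rw [h, map_zero]))
  have hfix' : ∀ σ τ : Perm (Fin n),
      rename (fun P : Fin n × Fin n => (σ P.1, τ P.2)) (C a * ∏ i, L' i) = C a * ∏ i, L' i := by
    intro σ τ
    rw [← hf', htboth, hfix τ σ]
  -- the transposed labelling
  set S' : MvPolynomial (Fin n × Fin n) ℂ → Finset (Fin n) := fun q => R (t q) with hS'
  have hS'L' : ∀ i, S' (L' i) = R (L i) := fun i => by simp only [hS', hL', htt]
  have S'1 : ∀ (q : MvPolynomial (Fin n × Fin n) ℂ) (u : ℂ), u ≠ 0 → S' (C u * q) = S' q := by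
    intro q u hu
    simp only [hS', map_mul, htC, R1 _ u hu]
  have S'2 : ∀ (q : MvPolynomial (Fin n × Fin n) ℂ) (τ : Perm (Fin n)),
      S' (vact (K := ℂ) colHom τ q) = τ • S' q := by
    intro q τ
    simp only [hS']
    rw [← htvrow, R2]
  have S'3 : ∀ (q : MvPolynomial (Fin n × Fin n) ℂ) (σ : Perm (Fin n)),
      S' (vact (K := ℂ) rowHom σ q) = S' q := by
    intro q σ
    simp only [hS']
    rw [← htvcol, R3]
  have hS'k : ∀ i, (S' (L' i)).card ≤ c₀ := fun i => by rw [hS'L']; exact hRk i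
  have hS'fix : ∀ (i : ι) (ρ : Perm (Fin n)), (∀ x ∈ S' (L' i), ρ x = x) →
      vact (K := ℂ) colHom ρ (L' i) = L' i := by
    intro i ρ hρ
    rw [hS'L'] at hρ
    show vact (K := ℂ) colHom ρ (t (L i)) = t (L i)
    rw [htvcol, hRfix i ρ hρ]
  have Hstab' : ∀ (τ : Perm (Fin n)) (T : Finset (Fin n)) (c : ℂ), (∃ i, S' (L' i) = T) → τ • T = T →
      rename (fun P : Fin n × Fin n => (P.1, τ P.2))
        (∏ i ∈ (univ : Finset ι).filter (fun i => S' (L' i) = T), L' i) =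
        C c * ∏ i ∈ (univ : Finset ι).filter (fun i => S' (L' i) = T), L' i → c = 1 := by
    intro τ T c hocc hτT h
    simp_rw [hS'L'] at hocc h
    have hprod : (∏ i ∈ (univ : Finset ι).filter (fun i => R (L i) = T), L' i) =
        t (∏ i ∈ (univ : Finset ι).filter (fun i => R (L i) = T), L i) := by
      rw [map_prod]
    rw [hprod, htcol, ← htC, ← map_mul] at h
    exact Hstab τ T c hocc hτT (htinj h)
  have hmem := prod_mem_narrowSpan_of_colStabUntwisted_supports c₀ hc₀ L' a hL1' hf0' hfix' S' S'1 S'2 S'3 hS'k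
    hS'fix Hstab'
  have hback : C a * ∏ i, L i = rename (fun P : Fin n × Fin n => (P.2, P.1)) (C a * ∏ i, L' i) := by
    rw [← hf']
    exact (htt _).symm
  rw [hback]
  exact rename_swap_mem_narrowSpan n (2 * c₀ + 1) hmem

end SuperAtoms

end Summit.ValiantsHypothesis.ValiantsHypothesis.Theorems

end
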